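/-
Lead `ym-line-sgb-k1` (seat prover-ym-line-sgb-k1-g0-0), route `SteinGapBootstrap`, crux `SteinBlockTransferG`
(stmt-QuantumFields-22998), line `birth`: registered stub `stub_axisTransport`, BY NAME.
-/
import Summits.QuantumFields.YangMills.Theorems.SteinGapBootstrapGapGivesClusteringGCSForm
import Literature.MathematicalPhysics.QuantumLattice.LatticeGaugeDLRSymmetry

/-!
# Crux `SteinBlockTransferG`, line `birth` («all-axes transfer»): STUB 1 `stub_axisTransport` — CLOSED

Axis symmetry (ii) and time-hyperplane pair clustering (iii) of a torus-limit state give pair clustering across EVERY axis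
hyperplane, for bounded continuous cylinder observables `A`, `B` supported in the closed halves `{x_i ≤ 0}` (links in direction
`i` based at `x_i ≤ -1`) and `{x_i ≥ t}`:  `|∫ A B dμ − ∫ A dμ ∫ B dμ| ≤ 2 e^{−m t} a b`.

Proof (kernel glue, [folklore]; Seiler LNP 159 Ch. 2 for the symmetries).
* Time axis (`timeAxis_pairClustering`, any `d`): the site reflection `θ = timeReflectLG` is an involution carrying the support
  conditions `x₀ ≤ 0` (spatial links) / `x₀ ≤ −1` (temporal links) onto the positive-time half, so `A = A' ∘ θ` with
  `A' := A ∘ θ` a positive-time observable (`IsPosTimeObs`); and `B = B' ∘ α_t` with `B' := B ∘ (shift by −t e₀)` positive-time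
  because `SB ⊂ {x₀ ≥ t}`.  Hypothesis (iii) for `(A', B')` at time `t` is the claim.
* Axis `i ≠ 0` (`d = 4`): the relabelling `R = relabelConfig (edgePerm (swap 0 i))` exchanges the coordinates `0` and `i`; by (ii)
  `Cov_μ(A, B) = Cov_μ(A ∘ R, B ∘ R)`, and `A ∘ R`, `B ∘ R` satisfy the time-axis support conditions.
No new definitions.  HONEST FRAMING: a symmetry bookkeeping step of a line on the RECORD-label rung R2ξ′ (`XiPow`, an upper bound on
lattice gaps); nothing here bears on the Yang–Mills mass gap.
-/

set_option autoImplicit false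

noncomputable section

open MeasureTheory Filter Topology
open Literature.MathematicalPhysics
open Literature.MathematicalPhysics.QuantumFieldTheory hiding ZdEdge Site edgePerm sitePerm sitePerm_apply
open Literature.MathematicalPhysics.QuantumLattice
open Summit.QuantumFields.YangMills.Theorems.WeakCouplingRates
open Summit.QuantumFields.YangMills.Theorems.SteinGapBootstrapK2CS
open Summit.QuantumFields.GaugeBoot

namespace Summit.QuantumFields.YangMills.Cruxes.SteinBlockTransferG.AllAxesTransfer

section General

variable {d : ℕ} {G : Type*} [Group G] [TopologicalSpace G] [IsTopologicalGroup G] [CompactSpace G]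
  [MeasurableSpace G] [BorelSpace G]

omit [Group G] [TopologicalSpace G] [IsTopologicalGroup G] [CompactSpace G] [BorelSpace G] in
/-- Undoing the time shift: `(shift by −t e₀) ∘ α_t = id`. -/
theorem configShift_single_timeShiftLG [NeZero d] (t : ℕ) (U : LGConfig d G) :
    configShift (Pi.single 0 (t : ℤ)) (timeShiftLG (G := G) t U) = U := by
  ext e
  simp [timeShiftLG, configShift_apply]

omit [Group G] [TopologicalSpace G] [IsTopologicalGroup G] [CompactSpace G] [BorelSpace G] in
/-- A cylinder observable read on a relabelled field is a cylinder observable on the pulled-back support. -/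
theorem isCylinder_comp_relabelConfig {α : Type*} {F : LGConfig d G → α} {S : Finset (QuantumLattice.ZdEdge d)}
    (hF : IsCylinder F S) (φ : QuantumLattice.ZdEdge d ≃ QuantumLattice.ZdEdge d) :
    IsCylinder (fun U => F (relabelConfig φ U)) (S.image φ.symm) := by
  intro U V hUV
  refine hF fun e he => ?_
  simp only [relabelConfig_apply]
  exact hUV _ (by
    rw [Finset.coe_image]
    exact ⟨e, he, rfl⟩)

omit [Group G] [IsTopologicalGroup G] [CompactSpace G] [BorelSpace G] in
/-- Relabelling is continuous (product topology). -/
theorem continuous_relabelConfig (φ : QuantumLattice.ZdEdge d ≃ QuantumLattice.ZdEdge d) :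
    Continuous (relabelConfig (G := G) φ : LGConfig d G → LGConfig d G) := by
  refine continuous_pi fun e => ?_
  simp only [relabelConfig_apply]
  exact continuous_apply _

omit [CompactSpace G] [BorelSpace G] in
/-- **Time-axis pair clustering for half-space observables.**  If `μ` is pair-clustering across the time hyperplane at rate `m`
in the RP form (hypothesis (iii) of `SteinBlockTransferG`: observables `A ∘ θ`, `B ∘ α_t` with `A`, `B` positive-time), then for
bounded continuous cylinder observables `A` supported in `{x₀ ≤ 0}` (temporal links at `x₀ ≤ −1`) and `B` supported in
`{x₀ ≥ t}`, `|∫ A B dμ − ∫ A dμ ∫ B dμ| ≤ 2 e^{−m t} a b`. -/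
theorem timeAxis_pairClustering [NeZero d] {μ : Measure (LGConfig d G)} {m : ℝ}
    (hclus : ∀ (A B : LGConfig d G → ℝ), IsPosTimeObs A → IsPosTimeObs B → ∀ a b : ℝ, (∀ U, |A U| ≤ a) →
      (∀ U, |B U| ≤ b) → ∀ t : ℕ, |(∫ U, A (timeReflectLG U) * B (timeShiftLG (G := G) t U) ∂μ) -
        (∫ U, A (timeReflectLG U) ∂μ) * (∫ U, B (timeShiftLG (G := G) t U) ∂μ)| ≤ 2 * Real.exp (-(m * t)) * a * b)
    (t : ℕ) {A B : LGConfig d G → ℝ} {SA SB : Finset (QuantumLattice.ZdEdge d)}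
    (hA : IsCylinder A SA) (hB : IsCylinder B SB) (hAc : Continuous A) (hBc : Continuous B)
    (hSA : ∀ e ∈ SA, e.1 0 ≤ 0 ∧ (e.2 = 0 → e.1 0 ≤ -1)) (hSB : ∀ e ∈ SB, (t : ℤ) ≤ e.1 0)
    {a b : ℝ} (ha : ∀ U, |A U| ≤ a) (hb : ∀ U, |B U| ≤ b) :
    |(∫ U, A U * B U ∂μ) - (∫ U, A U ∂μ) * (∫ U, B U ∂μ)| ≤ 2 * Real.exp (-(m * t)) * a * b := by
  -- `A' := A ∘ θ` and `B' := B ∘ (shift by −t e₀)` are positive-time observables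
  have hA' : IsPosTimeObs (fun U => A (timeReflectLG U)) := by
    refine ⟨⟨_, isCylinder_timeReflect hA, fun e he => ?_⟩, hAc.comp continuous_timeReflectLG, a, fun U => ha _⟩
    obtain ⟨e', he', rfl⟩ := Finset.mem_image.1 he
    obtain ⟨h0, h1⟩ := hSA e' he'
    by_cases hk : e'.2 = 0
    · have := h1 hk
      simp [hk, zdSiteReflect]
      omega
    · simp [hk, zdSiteReflect]
      omega
  have hB' : IsPosTimeObs (fun U => B (configShift (Pi.single 0 (t : ℤ)) U)) := by
    refine ⟨⟨_, IsCylinder.comp_configShift hB (Pi.single 0 (t : ℤ)), fun e he => ?_⟩,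
      hBc.comp (continuous_configShift _), b, fun U => hb _⟩
    obtain ⟨e', he', rfl⟩ := Finset.mem_image.1 he
    have := hSB e' he'
    simp
    omega
  have h := hclus _ _ hA' hB' a b (fun U => ha _) (fun U => hb _) t
  simp only [timeReflectLG_timeReflectLG, configShift_single_timeShiftLG] at h
  exact h

end General

/-- **Registered stub `stub_axisTransport` of crux `SteinBlockTransferG` (line `birth`), CLOSED**: axis symmetry (ii) and
time-hyperplane pair clustering (iii) of a torus-limit state give pair clustering across every axis hyperplane, for bounded
continuous cylinder observables supported in the closed halves `{x_i ≤ 0}` and `{x_i ≥ t}`. [cite: SeilerLNP1982, Ch. 2] -/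
theorem stub_axisTransport :
    ∀ (G : Type) [Group G] [TopologicalSpace G] [IsTopologicalGroup G] [CompactSpace G], Literature.MathematicalPhysics.QuantumFieldTheory.IsCompactSimpleLieGroup G → (letI : MeasurableSpace G := borel G; haveI : BorelSpace G := ⟨rfl⟩; ∀ r : Literature.MathematicalPhysics.QuantumFieldTheory.LatticeRep G, ∀ β : ℝ, ∀ μ ∈ Literature.MathematicalPhysics.QuantumLattice.infiniteVolumeLimitPoints (d := 4) r.ρ β, (∀ (σ : Equiv.Perm (Fin 4)) (F : Literature.MathematicalPhysics.QuantumLattice.LGConfig 4 (G) → ℝ) (S : Finset (Literature.MathematicalPhysics.QuantumLattice.ZdEdge 4)), Literature.MathematicalPhysics.QuantumLattice.IsCylinder F S → Continuous F → (∃ C, ∀ U, |F U| ≤ C) → ∫ U, F (Literature.MathematicalPhysics.QuantumLattice.relabelConfig (Literature.MathematicalPhysics.QuantumLattice.edgePerm σ) U) ∂μ = ∫ U, F U ∂μ) → ∀ m : ℝ, 0 < m → (∀ (A B : Literature.MathematicalPhysics.QuantumLattice.LGConfig 4 (G) → ℝ), Summit.QuantumFields.YangMills.Theorems.WeakCouplingRates.IsPosTimeObs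 A → Summit.QuantumFields.YangMills.Theorems.WeakCouplingRates.IsPosTimeObs B → ∀ a b : ℝ, (∀ U, |A U| ≤ a) → (∀ U, |B U| ≤ b) → ∀ t : ℕ, |(∫ U, A (Summit.QuantumFields.YangMills.Theorems.WeakCouplingRates.timeReflectLG U) * B (Summit.QuantumFields.YangMills.Theorems.WeakCouplingRates.timeShiftLG (G := G) t U) ∂μ) - (∫ U, A (Summit.QuantumFields.YangMills.Theorems.WeakCouplingRates.timeReflectLG U) ∂μ) * (∫ U, B (Summit.QuantumFields.YangMills.Theorems.WeakCouplingRates.timeShiftLG (G := G) t U) ∂μ)| ≤ 2 * Real.exp (-(m * t)) * a * b) → (∀ (i : Fin 4) (t : ℕ) (A B : Literature.MathematicalPhysics.QuantumLattice.LGConfig 4 (G) → ℝ) (SA SB : Finset (Literature.MathematicalPhysics.QuantumLattice.ZdEdge 4)), Literature.MathematicalPhysics.QuantumLattice.IsCylinder A SA → Literature.MathematicalPhysics.QuantumLattice.IsCylinder B SB → Continuous A → Continuous B → (∀ e ∈ SA, e.1 i ≤ 0 ∧ (e.2 = i → e.1 i ≤ -1)) → (∀ e ∈ SB, (t : ℤ)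 ≤ e.1 i) → ∀ a b : ℝ, (∀ U, |A U| ≤ a) → (∀ U, |B U| ≤ b) → |(∫ U, A U * B U ∂μ) - (∫ U, A U ∂μ) * (∫ U, B U ∂μ)| ≤ 2 * Real.exp (-(m * t)) * a * b)) := by
  intro G _ _ _ _ _hG
  letI : MeasurableSpace G := borel G
  haveI : BorelSpace G := ⟨rfl⟩
  intro r β μ _hμ hii m _hm hiii i t A B SA SB hA hB hAc hBc hSA hSB a b ha hb
  by_cases hi : i = 0
  · subst hi
    exact timeAxis_pairClustering hiii t hA hB hAc hBc hSA hSB ha hb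
  · -- exchange the axes `0` and `i` by the relabelling along `edgePerm (swap 0 i)`, under which `μ` is invariant by (ii)
    set σ : Equiv.Perm (Fin 4) := Equiv.swap 0 i with hσ
    set R : LGConfig 4 G → LGConfig 4 G := fun U => relabelConfig (edgePerm σ) U with hR
    have hRc : Continuous R := continuous_relabelConfig (edgePerm σ)
    have hAR : IsCylinder (fun U => A (R U)) (SA.image (edgePerm σ).symm) := isCylinder_comp_relabelConfig hA _
    have hBR : IsCylinder (fun U => B (R U)) (SB.image (edgePerm σ).symm) := isCylinder_comp_relabelConfig hB _
    have hσ0 : σ 0 = i := by rw [hσ, Equiv.swap_apply_left]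
    have hσsymm : ∀ k : Fin 4, σ.symm k = 0 ↔ k = i := fun k => by
      rw [Equiv.symm_apply_eq, hσ0]
    have hSA' : ∀ e ∈ SA.image (edgePerm σ).symm, e.1 0 ≤ 0 ∧ (e.2 = 0 → e.1 0 ≤ -1) := by
      intro e he
      obtain ⟨e', he', rfl⟩ := Finset.mem_image.1 he
      obtain ⟨h0, h1⟩ := hSA e' he'
      simp only [edgePerm_symm_apply, sitePerm_apply, Equiv.symm_symm, hσ0]
      exact ⟨h0, fun hk => h1 ((hσsymm _).1 hk)⟩
    have hSB' : ∀ e ∈ SB.image (edgePerm σ).symm, (t : ℤ) ≤ e.1 0 := by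
      intro e he
      obtain ⟨e', he', rfl⟩ := Finset.mem_image.1 he
      have := hSB e' he'
      simp only [edgePerm_symm_apply, sitePerm_apply, Equiv.symm_symm, hσ0]
      exact this
    have hcov := timeAxis_pairClustering hiii t hAR hBR (hAc.comp hRc) (hBc.comp hRc) hSA' hSB'
      (a := a) (b := b) (fun U => ha _) (fun U => hb _)
    -- (ii): `μ` is invariant under `R` on bounded continuous cylinder observables
    have ha0 : 0 ≤ a := (abs_nonneg _).trans (ha fun _ => 1)
    have hAB : IsCylinder (fun U => A U * B U) (SA ∪ SB) := IsCylinder.mul hA hB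
    have hIAB : ∫ U, A (R U) * B (R U) ∂μ = ∫ U, A U * B U ∂μ :=
      hii σ (fun U => A U * B U) _ hAB (hAc.mul hBc) ⟨a * b, fun U => by
        rw [abs_mul]; exact mul_le_mul (ha _) (hb _) (abs_nonneg _) ha0⟩
    have hIA : ∫ U, A (R U) ∂μ = ∫ U, A U ∂μ := hii σ A SA hA hAc ⟨a, ha⟩
    have hIB : ∫ U, B (R U) ∂μ = ∫ U, B U ∂μ := hii σ B SB hB hBc ⟨b, hb⟩
    rw [← hIAB, ← hIA, ← hIB]
    exact hcov

end Summit.QuantumFields.YangMills.Cruxes.SteinBlockTransferG.AllAxesTransfer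

end
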